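import Summits.QuantumFields.YangMills.Theorems.BalabanUVNodesK0Stub1CurlCurlRowOfEq158
import Summits.QuantumFields.YangMills.Theorems.BalabanUVNodesK0Stub1MultiplierLetterP
import Literature.MathematicalPhysics.QuantumFieldTheory.Balaban1983to89.Node00.TorusCoverLandau153RE
import HarnessLib

/-!
# K0⁷ STUB 1 (`stub_prop8StepCoP13`), sub-target S4a — **THE `∂^{ξ*}∂^ξ` ROW OF THE TANGENT COMPONENT AT THE HEAD's OBJECTS**: p608822's Δ_a-row (`∂*∂A₁ = −(1 − 𝔐)w` on the
# slice) WITH THE MULTIPLIER LETTER DISCHARGED by k0-s1-w4's p607974 (`‖𝔐_Vf(b)‖ ≤ (B₀B₃ + 1)·L·C_G·β` on top windows) at EVERY admissible nested family of the record's tori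
# (P9 `body_of_adm22_T4`), and THE SLICE (153) DISCHARGED at the head's datum tower `cubeDomains` by n07-w3's `RE_dsE_re_eq_zero_of_cubeDomains` — displayed after this
# file for the `A₁` summand's third (10)-letter: ONLY Prop. 4's slot `hWq` (S4b), (128) (S2), the sizes (S3), the chart datum `𝔇(A′)` of (157) (S2), the port's `G_a` band row

Cell `pub-ymgap`, width seat `pub-ymgap-k0-s1-w1` g4 (OFFER-2 ∕ INTENT-2).  `--kind proof --supports stmt-QuantumFields-20541 --as helper`; count-neutral; def-free.
[15] = [Balaban1985Variational]; [B6] = [Balaban1984PropagatorsII]; [6] = [Balaban1985RegularSpaces].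

WHY.  The S6 head (`N07Letters10OfRealRows.letters10On_of_realRows` ∕ `…_of_weightedRowsTop`) reads, per duality reading and per bond of a top window `Y`, three real rows
of each summand of (159); for `A₁ = A′ − H(Q A′)` the first two are p604735's and the third is p608822's `curlCurl_row_of_critical128`, whose two outside letters are now
tree theorems: the multiplier letter `𝔐 = Q*(QGQ*)⁻¹QG` (print p. 298 after (133), *«the right-hand side of (133) can be estimated by O(1)…»*; k0-s1-w4 `K0Stub1MultiplierLetterP`)
and, at the datum tower of the head's recipe, the residual-Landau slice (153) *«R d^{η*}A = 0»* for the gauge-fixed potential (n07-w3 `Node00.TorusCoverLandau153RE`), which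
p608822 §2 moves along (157) `A′ = A + H𝔇(A′)`.  THIS FILE composes them — nothing of Bałaban's analysis is added.

WHAT IS PROVED (sorry-free; no definition; axioms standard).
* §1 ★★ `curlCurl_row_of_critical128_model_mat` ∕ §2 ★★ `curlCurl_row_of_critical128_mat` — p608822 §3 ∕ §4 with the multiplier letter in k0-s1-w4's MATRIX shape
  `hMmat : ∀ g β, 0 ≤ β → (∀ b, wt₃ b·‖g b‖ ≤ β) → ∀ b ∈ S, ‖𝔐_Vg(b)‖ ≤ B_𝔐·β` (`|Re φ((𝔐_Vw) b)| ≤ ‖(𝔐_Vw) b‖`, no reading of the multiplier term needed).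
* §3 ★★★ `exists_curlCurl_row_of_adm22_T4` — for every `F : T4Family`: thresholds `Mh₀, R₀` and constants `B₀, δ₀ > 0, B₃ > 0` (P9's) such that at every admissible nested
  family `D` of top level `K − n` on `Site (F.P K) 0` (`Adm22 D R (L·M_h)`, `M_h = L^{a′} ≥ Mh₀`, `R ≥ R₀`, `a′ + 3 ≤ m + n`, `2L ≤ R·(L·M_h)`), the (152) level weights, a `G_a`
  band sup row with constant `C_G` (displayed, k0-s1-w4's binder shape), the S4a block of p604735∕p608822 (`Δ_V, G̃_V, 𝔐_V, Q_V, H_V` at `c = L^{K−n}`, `a ≡ 1`; `hWq`; `𝔰𝔲(N)`-valued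
  `X`, `W X` skew∕traceless; (128); sizes) and the slice for every reading `Re φ ∘ X`: on every top window `Y ⊆ Ω_{K−n}`, for every duality reading of norm `≤ 1` and every bond
  `b₋ ∈ Y`, `|dcsE L^{K−n} (dcE L^{K−n} (b′ ↦ r·Re(u·f(A₁ b′)))) b| ≤ (1 + (B₀B₃ + 1)·L·C_G)·(C₄·ρ²)` — the multiplier letter DISCHARGED (`multiplierLetter_matrix_of_bodyAt_adm22`).
* §4 ★★ `hslice_of_cubeDomains_add_HV` (generic `P`) — at the datum tower `D := Node00.cubeDomains P c.a c.M c.ρ c.k _` of a `CubeB8` datum: n07-w3's (153) hypothesis block for a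
  potential `A` (non-wrapping `Set.InjOn (cover P) □₀`, the sixth conjunct «`A = A′ ∘ cover` on `□₀` ∧ `IsLandau138 …`») and ANY `H_V`-image `X = A + H_VB′` ((157): `A′ = A + H𝔇(A′)`)
  ⇒ `∀ φ, RE D c (dsE c (toLp (Re φ ∘ X))) = 0` at `c = η⁻¹` — LITERALLY the `hslice` binder of §2∕§3∕p608822 §4.
HONEST SCOPE.  Composition by name; NO estimate proved here; displayed after this file: `hWq` (S4b), (128) (S2), `h1 h2` sizes (S3), the `G_a` band row (k0-s1-w4's FILE 2
`…MultiplierLetterAtRecord` closes it), the chart datum `B′ = 𝔇(A′)` (S2), and n07-w3's hypotheses at the datum.  FLAT background; `stub_prop8StepCoP13` ∕ K0⁷ NOT closed; N07 NOT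
discharged; counts unmoved (28∕28 · 5∕27); one finite 𝕋⁴ programme at fixed ε — R4 closes the conditional finite-𝕋⁴ rung `BalabanLadder.UV` only, never the summit; the YM mass gap
(Clay) is NOT proved by any of this; nothing continuum ∕ ℝ⁴ ∕ OS.  No `sorry`, no `def`, no `instance`, no `notation`.

References: [15] (128) p.297, (131)–(133) p.298, (152)–(153) p.301, (157)–(159) pp.302–303, (165) p.304; [B6] (2.1)–(2.2) p.224, (2.12) p.225, (2.19) p.226, (2.35) p.228,
Cor. 2.8 (2.150)–(2.151) p.249.
-/

set_option autoImplicit false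
noncomputable section
open scoped BigOperators InnerProductSpace Matrix Matrix.Norms.L2Operator

namespace Summit.QuantumFields.YangMills.Theorems.K0Stub1CurlCurlRowAtCubeDomains

open Literature.MathematicalPhysics.QuantumFieldTheory.Balaban1983to89
open Literature.MathematicalPhysics.QuantumFieldTheory.Balaban1983to89.T4Continuum (T4Family)
open Literature.MathematicalPhysics.QuantumFieldTheory.BalabanImbrieJaffe1984to88.BIJ85AxialPropagator411 (BondSpace)
open B6SectADomainsV1 (Domains)
open B6SectAOperatorsV1 (BondIdx BondIdxSpace QE QsE RE dsE dcE dcsE)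
open B6SectAVectorModelV1 (deltaAE GE EE)
open B6SectA (hOp)
open T4AdjointCovarianceUnitary (lieSU mem_lieSU_iff)
open B15Eq112TorusCover (cover)
open B8Eq138LandauZd (IsLandau138)
open Node00 (cubeDomains CubeB8 MatA RE_dsE_re_eq_zero_of_cubeDomains)
open Summit.QuantumFields.YangMills.Theorems.FlatCubeOpsText (Adm22)
open Summit.QuantumFields.YangMills.Theorems.K0FlatCubeOpsTextP (IsLevWeight IsFlatGW GtSupLetterG levWeight_nonneg)
open Summit.QuantumFields.YangMills.Theorems.K0FlatPortBodyP (body_of_adm22_T4)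
open Summit.QuantumFields.YangMills.Theorems.K0Stub1MultiplierLetterP (multiplierLetter_matrix_of_bodyAt_adm22 levWeight_eq_one_of_inOm_top)
open Summit.QuantumFields.YangMills.Theorems.K0Stub1CurlCurlRowOfEq158 (duality_reading_eq_re dcsE_dcE_re_reading_of_solution RE_dsE_re_reading_sub_HV
  RE_dsE_re_reading_add_HV eq158_flatOps_matrixFields_inst)
open Summit.QuantumFields.YangMills.Theorems.K0Stub1Letter165OfCriticalFlatOps (pairing_skew_of_traceless pairing_traceless_of_lieSU coe_lieSU_skew coe_lieSU_trace)

variable {N : ℕ}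

/-! ## §1  The row with the multiplier letter in MATRIX shape, model level -/

section Model

variable {P : Params} (D : Domains P) {c : ℝ} (hc : c ≠ 0) {w : BondIdx D → ℝ} (hw : ∀ i, 0 < w i)
variable {n : Type*} [Fintype n] [DecidableEq n]

/-- ★★ **p608822 §3 WITH THE MULTIPLIER LETTER IN MATRIX SHAPE** (k0-s1-w4's `multiplierLetter_matrix`: `‖𝔐_Vg(b)‖ ≤ B_𝔐·β` on `S` whenever `wt₃‖g‖ ≤ β`): (128) + (98)-slot + sizes +
slice + `wt₃ = 1` on `S` ⇒ `|dcsE c (dcE c (b′ ↦ r·Re(u·f(A₁ b′)))) b| ≤ (1 + B_𝔐)·(C₄·ρ²)` on `S`, `A₁ = A′ − H_V(Q_VA′)` — the multiplier term read as `|Re φ((𝔐_Vw) b)| ≤ ‖(𝔐_Vw) b‖`.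
[cite: Balaban1985Variational, (128) p.297, (131)–(133) p.298, (158) p.302, (165) p.304; Balaban1984PropagatorsII, (2.19) p.226, (2.35) p.228] -/
theorem curlCurl_row_of_critical128_model_mat {instDE : DecidableEq (PBond P 0)} {instDB : DecidableEq (BondIdx D)}
    (wt : ℕ → PBond P 0 → ℝ) (hw0 : ∀ m b, 0 ≤ wt m b)
    {DV GV MV : (PBond P 0 → Matrix n n ℂ) →ₗ[ℂ] (PBond P 0 → Matrix n n ℂ)} {QV : (PBond P 0 → Matrix n n ℂ) →ₗ[ℂ] (BondIdx D → Matrix n n ℂ)}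
    {HV : (BondIdx D → Matrix n n ℂ) →ₗ[ℂ] (PBond P 0 → Matrix n n ℂ)}
    (hDV : ∀ (A : PBond P 0 → Matrix n n ℂ) (b : PBond P 0),
      DV A b = ∑ j, ((WithLp.ofLp (deltaAE D c w (WithLp.toLp 2 (Pi.single j 1))) b : ℝ) : ℂ) • A j)
    (hGV : ∀ (A : PBond P 0 → Matrix n n ℂ) (b : PBond P 0),
      GV A b = ∑ j, ((WithLp.ofLp ((GE D hc hw - hOp (GE D hc hw) (QsE D) (EE D hc hw) ∘ₗ QE D ∘ₗ GE D hc hw)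
        (WithLp.toLp 2 (Pi.single j 1))) b : ℝ) : ℂ) • A j)
    (hQV : ∀ (A : PBond P 0 → Matrix n n ℂ) (t : BondIdx D),
      QV A t = ∑ j, ((WithLp.ofLp (QE D (WithLp.toLp 2 (Pi.single j 1))) t : ℝ) : ℂ) • A j)
    (hHV : ∀ (B : BondIdx D → Matrix n n ℂ) (b : PBond P 0),
      HV B b = ∑ t, ((WithLp.ofLp (hOp (GE D hc hw) (QsE D) (EE D hc hw) (WithLp.toLp 2 (Pi.single t 1))) b : ℝ) : ℂ) • B t)
    (hMV : ∀ (A : PBond P 0 → Matrix n n ℂ) (b : PBond P 0),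
      MV A b = ∑ j, ((WithLp.ofLp ((QsE D ∘ₗ EE D hc hw ∘ₗ QE D ∘ₗ GE D hc hw) (WithLp.toLp 2 (Pi.single j 1))) b : ℝ) : ℂ) • A j)
    (W : (PBond P 0 → Matrix n n ℂ) → (PBond P 0 → Matrix n n ℂ)) {C₄ a₃ ρ ℓ : ℝ}
    (hWq : ∀ (Y : PBond P 0 → Matrix n n ℂ) (r : ℝ), r < a₃ → (∀ b, wt 1 b * ‖Y b‖ ≤ r) →
      (∀ (b : PBond P 0) (ν : Fin P.d), wt 2 b * ℓ * ‖Y ⟨b.src.shift ν, b.dir⟩ - Y b‖ ≤ r) →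
        ∀ b, wt 3 b * ‖W Y b‖ ≤ C₄ * r ^ 2)
    {A' : PBond P 0 → Matrix n n ℂ} (hA : ∀ j, (A' j)ᴴ = -A' j) (hWA : ∀ j, (W A' j)ᴴ = -(W A' j))
    (h128 : ∀ δ : PBond P 0 → Matrix n n ℂ, (∀ j, (δ j)ᴴ = -δ j) → QV δ = 0 →
      ∑ j, ((δ j)ᴴ * (DV A' j + W A' j)).trace.re = 0)
    (hρ : ρ < a₃) (h1 : ∀ b, wt 1 b * ‖A' b‖ ≤ ρ)
    (h2 : ∀ (b : PBond P 0) (ν : Fin P.d), wt 2 b * ℓ * ‖A' ⟨b.src.shift ν, b.dir⟩ - A' b‖ ≤ ρ)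
    (hslice : ∀ φ : Matrix n n ℂ →L[ℂ] ℂ, RE D c (dsE c (WithLp.toLp 2 (fun b => (φ (A' b)).re))) = 0)
    {S : Set (PBond P 0)} (hS : ∀ b ∈ S, wt 3 b = 1) {BM : ℝ}
    (hMmat : ∀ (g : PBond P 0 → Matrix n n ℂ) (β : ℝ), 0 ≤ β → (∀ b, wt 3 b * ‖g b‖ ≤ β) → ∀ b ∈ S, ‖MV g b‖ ≤ BM * β) :
    ∀ (f : Matrix n n ℂ →L[ℂ] ℂ) (u : ℂ) (r : ℝ), (∀ y : Matrix n n ℂ, |r * (u * f y).re| ≤ ‖y‖) →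
      ∀ b ∈ S, |dcsE c (dcE c (WithLp.toLp 2 fun b' => r * (u * f ((A' - HV (QV A')) b')).re)) b| ≤ (1 + BM) * (C₄ * ρ ^ 2) := by
  intro f u r hf b hb
  have hsol : (A' - HV (QV A')) + GV (W A') = 0 := by
    have h := eq158_flatOps_matrixFields_inst D hc hw hDV hGV hQV hHV W hA hWA h128
    rwa [sub_add_cancel] at h
  have hφ : ∀ y, r * (u * f y).re = (((((r : ℝ) : ℂ) * u) • f) y).re := fun y => duality_reading_eq_re f u r y
  have hφle : ∀ y, |(((((r : ℝ) : ℂ) * u) • f) y).re| ≤ ‖y‖ := fun y => (hφ y) ▸ hf y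
  have hsliceA₁ : RE D c (dsE c (WithLp.toLp 2 (fun b => (((((r : ℝ) : ℂ) * u) • f) ((A' - HV (QV A')) b)).re))) = 0 := by
    rw [RE_dsE_re_reading_sub_HV D hc hw hHV _ A' (QV A')]
    exact hslice _
  have key := dcsE_dcE_re_reading_of_solution D hc hw hGV hMV hsol ((((r : ℝ) : ℂ) * u) • f) hsliceA₁
  have hfun : (fun b' => r * (u * f ((A' - HV (QV A')) b')).re) = fun b' => (((((r : ℝ) : ℂ) * u) • f) ((A' - HV (QV A')) b')).re :=
    funext fun b' => hφ _
  rw [hfun, key, PiLp.add_apply, PiLp.neg_apply, PiLp.toLp_apply, PiLp.toLp_apply]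
  have hW : ∀ b', wt 3 b' * ‖W A' b'‖ ≤ C₄ * ρ ^ 2 := hWq A' ρ hρ h1 h2
  have hC : 0 ≤ C₄ * ρ ^ 2 := (mul_nonneg (hw0 3 b) (norm_nonneg _)).trans (hW b)
  have hwb : |(((((r : ℝ) : ℂ) * u) • f) (W A' b)).re| ≤ C₄ * ρ ^ 2 := by
    refine (hφle _).trans ?_
    have h := hW b
    rwa [hS b hb, one_mul] at h
  have hMb : |(((((r : ℝ) : ℂ) * u) • f) (MV (W A') b)).re| ≤ BM * (C₄ * ρ ^ 2) :=
    (hφle _).trans (hMmat (W A') (C₄ * ρ ^ 2) hC hW b hb)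
  calc |-(((((r : ℝ) : ℂ) * u) • f) (W A' b)).re + (((((r : ℝ) : ℂ) * u) • f) (MV (W A') b)).re|
      ≤ |-(((((r : ℝ) : ℂ) * u) • f) (W A' b)).re| + |(((((r : ℝ) : ℂ) * u) • f) (MV (W A') b)).re| := abs_add_le _ _
    _ ≤ C₄ * ρ ^ 2 + BM * (C₄ * ρ ^ 2) := by rw [abs_neg]; exact add_le_add hwb hMb
    _ = (1 + BM) * (C₄ * ρ ^ 2) := by ring

end Model

/-! ## §2  At NODE 00's fine torus (p604735's block, `𝔰𝔲(N)`-valued (128)), multiplier letter in matrix shape -/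

section Record

/-- ★★ **p608822 §4 WITH THE MULTIPLIER LETTER IN MATRIX SHAPE** — the door for k0-s1-w4's record editions (`multiplierLetter_matrix_of_bodyAt_adm22`,
`exists_multiplierLetter(_closed)_of_adm22_T4` with `ℳ := 𝔐_Vg`): `hMmat` + p604735's binder block + the slice + `wt₃ = 1` on `S` ⇒ the third real row of the head for
`A₁ = X − H_V(Q_VX)` on `S` with bound `(1 + B_𝔐)·(C₄·ρ²)`.
[cite: Balaban1985Variational, (128) p.297, (131)–(133) p.298, (152)–(153) p.301, (158) p.302, (165) p.304; Balaban1984PropagatorsII, (2.19) p.226, (2.35) p.228] -/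
theorem curlCurl_row_of_critical128_mat (F : T4Family) (K k : ℕ) (wt : ℕ → PBond (F.P K) 0 → ℝ) (hw0 : ∀ m b, 0 ≤ wt m b)
    (D : Domains (F.P K))
    {instDE : DecidableEq (PBond (F.P K) 0)} {instDB : DecidableEq (BondIdx D)}
    {DV GV MV : (PBond (F.P K) 0 → Matrix (Fin N) (Fin N) ℂ) →ₗ[ℂ] (PBond (F.P K) 0 → Matrix (Fin N) (Fin N) ℂ)}
    {QV : (PBond (F.P K) 0 → Matrix (Fin N) (Fin N) ℂ) →ₗ[ℂ] (BondIdx D → Matrix (Fin N) (Fin N) ℂ)}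
    {HV : (BondIdx D → Matrix (Fin N) (Fin N) ℂ) →ₗ[ℂ] (PBond (F.P K) 0 → Matrix (Fin N) (Fin N) ℂ)}
    (hDV : ∀ (A : PBond (F.P K) 0 → Matrix (Fin N) (Fin N) ℂ) (b : PBond (F.P K) 0),
      DV A b = ∑ j, ((WithLp.ofLp (deltaAE D ((F.P K).L ^ k : ℝ) (fun _ => (1 : ℝ)) (WithLp.toLp 2 (Pi.single j 1))) b : ℝ) : ℂ) • A j)
    (hGV : ∀ (A : PBond (F.P K) 0 → Matrix (Fin N) (Fin N) ℂ) (b : PBond (F.P K) 0),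
      GV A b = ∑ j, ((WithLp.ofLp ((GE D (c := ((F.P K).L : ℝ) ^ k) (pow_ne_zero _ (Nat.cast_ne_zero.2 (F.P K).L_pos.ne')) (w := fun _ => (1 : ℝ)) (fun _ => one_pos)
        - hOp (GE D (c := ((F.P K).L : ℝ) ^ k) (pow_ne_zero _ (Nat.cast_ne_zero.2 (F.P K).L_pos.ne')) (w := fun _ => (1 : ℝ)) (fun _ => one_pos)) (QsE D)
            (EE D (c := ((F.P K).L : ℝ) ^ k) (pow_ne_zero _ (Nat.cast_ne_zero.2 (F.P K).L_pos.ne')) (w := fun _ => (1 : ℝ)) (fun _ => one_pos))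
          ∘ₗ QE D ∘ₗ GE D (c := ((F.P K).L : ℝ) ^ k) (pow_ne_zero _ (Nat.cast_ne_zero.2 (F.P K).L_pos.ne')) (w := fun _ => (1 : ℝ)) (fun _ => one_pos))
        (WithLp.toLp 2 (Pi.single j 1))) b : ℝ) : ℂ) • A j)
    (hQV : ∀ (A : PBond (F.P K) 0 → Matrix (Fin N) (Fin N) ℂ) (t : BondIdx D),
      QV A t = ∑ j, ((WithLp.ofLp (QE D (WithLp.toLp 2 (Pi.single j 1))) t : ℝ) : ℂ) • A j)
    (hHV : ∀ (B : BondIdx D → Matrix (Fin N) (Fin N) ℂ) (b : PBond (F.P K) 0),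
      HV B b = ∑ t, ((WithLp.ofLp (hOp (GE D (c := ((F.P K).L : ℝ) ^ k) (pow_ne_zero _ (Nat.cast_ne_zero.2 (F.P K).L_pos.ne')) (w := fun _ => (1 : ℝ)) (fun _ => one_pos))
        (QsE D) (EE D (c := ((F.P K).L : ℝ) ^ k) (pow_ne_zero _ (Nat.cast_ne_zero.2 (F.P K).L_pos.ne')) (w := fun _ => (1 : ℝ)) (fun _ => one_pos))
        (WithLp.toLp 2 (Pi.single t 1))) b : ℝ) : ℂ) • B t)
    (hMV : ∀ (A : PBond (F.P K) 0 → Matrix (Fin N) (Fin N) ℂ) (b : PBond (F.P K) 0),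
      MV A b = ∑ j, ((WithLp.ofLp ((QsE D
          ∘ₗ EE D (c := ((F.P K).L : ℝ) ^ k) (pow_ne_zero _ (Nat.cast_ne_zero.2 (F.P K).L_pos.ne')) (w := fun _ => (1 : ℝ)) (fun _ => one_pos)
          ∘ₗ QE D ∘ₗ GE D (c := ((F.P K).L : ℝ) ^ k) (pow_ne_zero _ (Nat.cast_ne_zero.2 (F.P K).L_pos.ne')) (w := fun _ => (1 : ℝ)) (fun _ => one_pos))
        (WithLp.toLp 2 (Pi.single j 1))) b : ℝ) : ℂ) • A j)
    (W : (PBond (F.P K) 0 → Matrix (Fin N) (Fin N) ℂ) → (PBond (F.P K) 0 → Matrix (Fin N) (Fin N) ℂ)) {C₄ a₃ ρ : ℝ}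
    (hWq : ∀ (Y : PBond (F.P K) 0 → Matrix (Fin N) (Fin N) ℂ) (r : ℝ), r < a₃ → (∀ b, wt 1 b * ‖Y b‖ ≤ r) →
      (∀ (b : PBond (F.P K) 0) (ν : Fin 4), wt 2 b * (F.L : ℝ) ^ k * ‖Y ⟨b.src.shift ν, b.dir⟩ - Y b‖ ≤ r) →
        ∀ b, wt 3 b * ‖W Y b‖ ≤ C₄ * r ^ 2)
    (X : PBond (F.P K) 0 → lieSU (Fin N))
    (hWA : ∀ j, (W (fun b => ((X b : lieSU (Fin N)) : Matrix (Fin N) (Fin N) ℂ)) j)ᴴ = -(W (fun b => ((X b : lieSU (Fin N)) : Matrix (Fin N) (Fin N) ℂ)) j))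
    (hWtr : ∀ j, (W (fun b => ((X b : lieSU (Fin N)) : Matrix (Fin N) (Fin N) ℂ)) j).trace = 0)
    (h128 : ∀ δ : PBond (F.P K) 0 → lieSU (Fin N), QV (fun j => ((δ j : lieSU (Fin N)) : Matrix (Fin N) (Fin N) ℂ)) = 0 →
      ∑ j, (((δ j : lieSU (Fin N)) : Matrix (Fin N) (Fin N) ℂ)ᴴ *
        (DV (fun b => ((X b : lieSU (Fin N)) : Matrix (Fin N) (Fin N) ℂ)) j + W (fun b => ((X b : lieSU (Fin N)) : Matrix (Fin N) (Fin N) ℂ)) j)).trace.re = 0)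
    (hρ : ρ < a₃) (h1 : ∀ b, wt 1 b * ‖((X b : lieSU (Fin N)) : Matrix (Fin N) (Fin N) ℂ)‖ ≤ ρ)
    (h2 : ∀ (b : PBond (F.P K) 0) (ν : Fin 4),
      wt 2 b * (F.L : ℝ) ^ k * ‖((X ⟨b.src.shift ν, b.dir⟩ : lieSU (Fin N)) : Matrix (Fin N) (Fin N) ℂ) - ((X b : lieSU (Fin N)) : Matrix (Fin N) (Fin N) ℂ)‖ ≤ ρ)
    (hslice : ∀ φ : Matrix (Fin N) (Fin N) ℂ →L[ℂ] ℂ,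
      RE D (((F.P K).L : ℝ) ^ k) (dsE (((F.P K).L : ℝ) ^ k) (WithLp.toLp 2 (fun b => (φ ((X b : lieSU (Fin N)) : Matrix (Fin N) (Fin N) ℂ)).re))) = 0)
    {S : Set (PBond (F.P K) 0)} (hS : ∀ b ∈ S, wt 3 b = 1) {BM : ℝ}
    (hMmat : ∀ (g : PBond (F.P K) 0 → Matrix (Fin N) (Fin N) ℂ) (β : ℝ), 0 ≤ β → (∀ b, wt 3 b * ‖g b‖ ≤ β) → ∀ b ∈ S, ‖MV g b‖ ≤ BM * β) :
    ∀ (f : Matrix (Fin N) (Fin N) ℂ →L[ℂ] ℂ) (u : ℂ) (r : ℝ), (∀ y : Matrix (Fin N) (Fin N) ℂ, |r * (u * f y).re| ≤ ‖y‖) →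
      ∀ b ∈ S,
        |dcsE (((F.P K).L : ℝ) ^ k) (dcE (((F.P K).L : ℝ) ^ k)
            (WithLp.toLp 2 fun b' => r * (u * f (((fun b => ((X b : lieSU (Fin N)) : Matrix (Fin N) (Fin N) ℂ)) -
              HV (QV fun b => ((X b : lieSU (Fin N)) : Matrix (Fin N) (Fin N) ℂ))) b')).re)) b|
          ≤ (1 + BM) * (C₄ * ρ ^ 2) := by
  have hc : (((F.P K).L : ℝ)) ^ k ≠ 0 := pow_ne_zero _ (Nat.cast_ne_zero.2 (F.P K).L_pos.ne')
  have h128' : ∀ δ : PBond (F.P K) 0 → Matrix (Fin N) (Fin N) ℂ, (∀ j, (δ j)ᴴ = -δ j) →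
      QV δ = 0 → ∑ j, ((δ j)ᴴ * (DV (fun b => ((X b : lieSU (Fin N)) : Matrix (Fin N) (Fin N) ℂ)) j +
        W (fun b => ((X b : lieSU (Fin N)) : Matrix (Fin N) (Fin N) ℂ)) j)).trace.re = 0 := by
    refine pairing_skew_of_traceless
      ((WithLp.linearEquiv 2 ℝ (PBond (F.P K) 0 → ℝ)).toLinearMap ∘ₗ deltaAE D (((F.P K).L : ℝ) ^ k) (fun _ => (1 : ℝ)) ∘ₗ
        (WithLp.linearEquiv 2 ℝ (PBond (F.P K) 0 → ℝ)).symm.toLinearMap)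
      ((WithLp.linearEquiv 2 ℝ (BondIdx D → ℝ)).toLinearMap ∘ₗ QE D ∘ₗ (WithLp.linearEquiv 2 ℝ (PBond (F.P K) 0 → ℝ)).symm.toLinearMap)
      (fun A b => ?_) (fun A t => ?_) (fun j => coe_lieSU_trace (X j)) hWtr (pairing_traceless_of_lieSU h128)
    · simp only [LinearMap.comp_apply, LinearEquiv.coe_coe, WithLp.coe_linearEquiv, WithLp.coe_symm_linearEquiv]; exact hDV A b
    · simp only [LinearMap.comp_apply, LinearEquiv.coe_coe, WithLp.coe_linearEquiv, WithLp.coe_symm_linearEquiv]; exact hQV A t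
  exact curlCurl_row_of_critical128_model_mat D hc (fun _ => one_pos) wt hw0 hDV hGV hQV hHV hMV W hWq (fun j => coe_lieSU_skew (X j)) hWA h128' hρ h1 h2
    hslice hS hMmat

/-- ★★★ **THE THIRD REAL ROW FOR `A₁` AT EVERY ADMISSIBLE FAMILY OF THE RECORD's TORI, THE MULTIPLIER LETTER DISCHARGED** (P9 `body_of_adm22_T4` ∘ k0-s1-w4
`multiplierLetter_matrix_of_bodyAt_adm22` ∘ §2): for every `F : T4Family` there are thresholds `Mh₀, R₀` and constants `B₀`, `δ₀ > 0`, `B₃ > 0` such that at every admissible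
nested family `D` of top level `K − n` (`1 ≤ K − n`, `K − n + 1 ≤ m + K`, `Adm22 D R (L·M_h)`, `M_h = L^{a′} ≥ Mh₀`, `R ≥ R₀`, `a′ + 3 ≤ m + n`, `2L ≤ R·(L·M_h)`), the (152) level weights
`w`, a `G_a` band sup row with constant `C_G` (displayed), the S4a block at `c = L^{K−n}`, `a ≡ 1` and the slice for every reading of `X`: on every top window `Y ⊆ Ω_{K−n}`, for every
duality reading of norm `≤ 1` and every bond `b₋ ∈ Y`: `|dcsE L^{K−n} (dcE L^{K−n} (b′ ↦ r·Re(u·f(A₁ b′)))) b| ≤ (1 + (B₀B₃ + 1)·L·C_G)·(C₄·ρ²)`, `A₁ = X − H_V(Q_VX)`.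
[cite: Balaban1985Variational, (128) p.297, (131)–(133) p.298, (152)–(153) p.301, (158) p.302, (165) p.304; Balaban1984PropagatorsII, (2.1)–(2.2) p.224, (2.19) p.226, (2.35) p.228, Cor. 2.8 (2.150)–(2.151) p.249] -/
theorem exists_curlCurl_row_of_adm22_T4 (F : T4Family) :
    ∃ (Mh₀ R₀ : ℕ) (B₀ δ₀ B₃ : ℝ), 0 < δ₀ ∧ 0 < B₃ ∧
    ∀ (n K : ℕ) (_ : 1 ≤ K - n) (_ : K - n + 1 ≤ F.m + K) {Mh R a' : ℕ} (_ : Mh = F.L ^ a') (_ : Mh₀ ≤ Mh) (_ : R₀ ≤ R)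
      (_ : a' + 3 ≤ F.m + n) (D : Domains (F.P K)) (_ : D.k = K - n) (_ : Adm22 D R (F.L * Mh)) (_ : 2 * F.L ≤ R * (F.L * Mh))
      (w : ℕ → PBond (F.P K) 0 → ℝ) (_ : IsLevWeight (F.P K) (K - n) D w)
      {instDE : DecidableEq (PBond (F.P K) 0)} {instDB : DecidableEq (BondIdx D)}
      {a : BondIdx D → ℝ} (ha : ∀ i, 0 < a i) {G : (PBond (F.P K) 0 → ℝ) →ₗ[ℝ] (PBond (F.P K) 0 → ℝ)} (_ : IsFlatGW (F.P K) (K - n) D ha G)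
      {CG : ℝ} (_ : 0 ≤ CG) (_ : GtSupLetterG (F.P K) (K - n) w G CG)
      (_ : ∀ c : BondIdx D, a c ≤ ((F.L : ℝ) ^ (K - n)) ^ (4 - 1) * (F.L : ℝ) ^ (c.1.1 : ℕ))
    {DV GV MV : (PBond (F.P K) 0 → Matrix (Fin N) (Fin N) ℂ) →ₗ[ℂ] (PBond (F.P K) 0 → Matrix (Fin N) (Fin N) ℂ)}
    {QV : (PBond (F.P K) 0 → Matrix (Fin N) (Fin N) ℂ) →ₗ[ℂ] (BondIdx D → Matrix (Fin N) (Fin N) ℂ)}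
    {HV : (BondIdx D → Matrix (Fin N) (Fin N) ℂ) →ₗ[ℂ] (PBond (F.P K) 0 → Matrix (Fin N) (Fin N) ℂ)}
    (hDV : ∀ (A : PBond (F.P K) 0 → Matrix (Fin N) (Fin N) ℂ) (b : PBond (F.P K) 0),
      DV A b = ∑ j, ((WithLp.ofLp (deltaAE D ((F.P K).L ^ (K - n) : ℝ) (fun _ => (1 : ℝ)) (WithLp.toLp 2 (Pi.single j 1))) b : ℝ) : ℂ) • A j)
    (hGV : ∀ (A : PBond (F.P K) 0 → Matrix (Fin N) (Fin N) ℂ) (b : PBond (F.P K) 0),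
      GV A b = ∑ j, ((WithLp.ofLp ((GE D (c := ((F.P K).L : ℝ) ^ (K - n)) (pow_ne_zero _ (Nat.cast_ne_zero.2 (F.P K).L_pos.ne')) (w := fun _ => (1 : ℝ)) (fun _ => one_pos)
        - hOp (GE D (c := ((F.P K).L : ℝ) ^ (K - n)) (pow_ne_zero _ (Nat.cast_ne_zero.2 (F.P K).L_pos.ne')) (w := fun _ => (1 : ℝ)) (fun _ => one_pos)) (QsE D)
            (EE D (c := ((F.P K).L : ℝ) ^ (K - n)) (pow_ne_zero _ (Nat.cast_ne_zero.2 (F.P K).L_pos.ne')) (w := fun _ => (1 : ℝ)) (fun _ => one_pos))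
          ∘ₗ QE D ∘ₗ GE D (c := ((F.P K).L : ℝ) ^ (K - n)) (pow_ne_zero _ (Nat.cast_ne_zero.2 (F.P K).L_pos.ne')) (w := fun _ => (1 : ℝ)) (fun _ => one_pos))
        (WithLp.toLp 2 (Pi.single j 1))) b : ℝ) : ℂ) • A j)
    (hQV : ∀ (A : PBond (F.P K) 0 → Matrix (Fin N) (Fin N) ℂ) (t : BondIdx D),
      QV A t = ∑ j, ((WithLp.ofLp (QE D (WithLp.toLp 2 (Pi.single j 1))) t : ℝ) : ℂ) • A j)
    (hHV : ∀ (B : BondIdx D → Matrix (Fin N) (Fin N) ℂ) (b : PBond (F.P K) 0),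
      HV B b = ∑ t, ((WithLp.ofLp (hOp (GE D (c := ((F.P K).L : ℝ) ^ (K - n)) (pow_ne_zero _ (Nat.cast_ne_zero.2 (F.P K).L_pos.ne')) (w := fun _ => (1 : ℝ)) (fun _ => one_pos))
        (QsE D) (EE D (c := ((F.P K).L : ℝ) ^ (K - n)) (pow_ne_zero _ (Nat.cast_ne_zero.2 (F.P K).L_pos.ne')) (w := fun _ => (1 : ℝ)) (fun _ => one_pos))
        (WithLp.toLp 2 (Pi.single t 1))) b : ℝ) : ℂ) • B t)
    (hMV : ∀ (A : PBond (F.P K) 0 → Matrix (Fin N) (Fin N) ℂ) (b : PBond (F.P K) 0),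
      MV A b = ∑ j, ((WithLp.ofLp ((QsE D
          ∘ₗ EE D (c := ((F.P K).L : ℝ) ^ (K - n)) (pow_ne_zero _ (Nat.cast_ne_zero.2 (F.P K).L_pos.ne')) (w := fun _ => (1 : ℝ)) (fun _ => one_pos)
          ∘ₗ QE D ∘ₗ GE D (c := ((F.P K).L : ℝ) ^ (K - n)) (pow_ne_zero _ (Nat.cast_ne_zero.2 (F.P K).L_pos.ne')) (w := fun _ => (1 : ℝ)) (fun _ => one_pos))
        (WithLp.toLp 2 (Pi.single j 1))) b : ℝ) : ℂ) • A j)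
    (W : (PBond (F.P K) 0 → Matrix (Fin N) (Fin N) ℂ) → (PBond (F.P K) 0 → Matrix (Fin N) (Fin N) ℂ)) {C₄ a₃ ρ : ℝ}
    (hWq : ∀ (Y : PBond (F.P K) 0 → Matrix (Fin N) (Fin N) ℂ) (r : ℝ), r < a₃ → (∀ b, w 1 b * ‖Y b‖ ≤ r) →
      (∀ (b : PBond (F.P K) 0) (ν : Fin 4), w 2 b * (F.L : ℝ) ^ (K - n) * ‖Y ⟨b.src.shift ν, b.dir⟩ - Y b‖ ≤ r) →
        ∀ b, w 3 b * ‖W Y b‖ ≤ C₄ * r ^ 2)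
    (X : PBond (F.P K) 0 → lieSU (Fin N))
    (hWA : ∀ j, (W (fun b => ((X b : lieSU (Fin N)) : Matrix (Fin N) (Fin N) ℂ)) j)ᴴ = -(W (fun b => ((X b : lieSU (Fin N)) : Matrix (Fin N) (Fin N) ℂ)) j))
    (hWtr : ∀ j, (W (fun b => ((X b : lieSU (Fin N)) : Matrix (Fin N) (Fin N) ℂ)) j).trace = 0)
    (h128 : ∀ δ : PBond (F.P K) 0 → lieSU (Fin N), QV (fun j => ((δ j : lieSU (Fin N)) : Matrix (Fin N) (Fin N) ℂ)) = 0 →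
      ∑ j, (((δ j : lieSU (Fin N)) : Matrix (Fin N) (Fin N) ℂ)ᴴ *
        (DV (fun b => ((X b : lieSU (Fin N)) : Matrix (Fin N) (Fin N) ℂ)) j + W (fun b => ((X b : lieSU (Fin N)) : Matrix (Fin N) (Fin N) ℂ)) j)).trace.re = 0)
    (hρ : ρ < a₃) (h1 : ∀ b, w 1 b * ‖((X b : lieSU (Fin N)) : Matrix (Fin N) (Fin N) ℂ)‖ ≤ ρ)
    (h2 : ∀ (b : PBond (F.P K) 0) (ν : Fin 4),
      w 2 b * (F.L : ℝ) ^ (K - n) * ‖((X ⟨b.src.shift ν, b.dir⟩ : lieSU (Fin N)) : Matrix (Fin N) (Fin N) ℂ) - ((X b : lieSU (Fin N)) : Matrix (Fin N) (Fin N) ℂ)‖ ≤ ρ)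
    (hslice : ∀ φ : Matrix (Fin N) (Fin N) ℂ →L[ℂ] ℂ,
      RE D (((F.P K).L : ℝ) ^ (K - n)) (dsE (((F.P K).L : ℝ) ^ (K - n)) (WithLp.toLp 2 (fun b => (φ ((X b : lieSU (Fin N)) : Matrix (Fin N) (Fin N) ℂ)).re))) = 0)
      {Y : Set (Site (F.P K) 0)} (_ : ∀ x ∈ Y, D.InOm (K - n) x)
      (f : Matrix (Fin N) (Fin N) ℂ →L[ℂ] ℂ) (u : ℂ) (r : ℝ) (_ : ∀ y : Matrix (Fin N) (Fin N) ℂ, |r * (u * f y).re| ≤ ‖y‖)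
      (b : PBond (F.P K) 0) (_ : b.src ∈ Y),
      |dcsE (((F.P K).L : ℝ) ^ (K - n)) (dcE (((F.P K).L : ℝ) ^ (K - n))
          (WithLp.toLp 2 fun b' => r * (u * f (((fun b => ((X b : lieSU (Fin N)) : Matrix (Fin N) (Fin N) ℂ)) -
            HV (QV fun b => ((X b : lieSU (Fin N)) : Matrix (Fin N) (Fin N) ℂ))) b')).re)) b|
        ≤ (1 + (B₀ * B₃ + 1) * (F.L : ℝ) * CG) * (C₄ * ρ ^ 2) := by
  obtain ⟨Mh₀, R₀, B₀, δ₀, B₃, hδ₀, hB₃, hmain⟩ := body_of_adm22_T4 F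
  refine ⟨Mh₀, R₀, B₀, δ₀, B₃, hδ₀, hB₃, ?_⟩
  intro n K hk1 hk' Mh R a' hMha hMh hR hsize D hDk hAdm hRM w hw instDE instDB a ha G hGW CG hCG hGsup hband DV GV MV QV HV hDV hGV hQV hHV hMV
    W C₄ a₃ ρ hWq X hWA hWtr h128 hρ h1 h2 hslice Y hY f u r hf b hb
  have hBody := hmain n K hk1 hk' hMha hMh hR hsize D hDk hAdm w hw
  have hc : (((F.P K).L : ℝ)) ^ (K - n) ≠ 0 := pow_ne_zero _ (Nat.cast_ne_zero.2 (F.P K).L_pos.ne')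
  -- the multiplier operator as a plain-function linear map (UST `exists_Mop` pattern)
  obtain ⟨Mop, hMop⟩ : ∃ Mop : (PBond (F.P K) 0 → ℝ) →ₗ[ℝ] (PBond (F.P K) 0 → ℝ), ∀ (g : PBond (F.P K) 0 → ℝ) (b : PBond (F.P K) 0),
      Mop g b = QsE D (EE D (c := ((F.P K).L : ℝ) ^ (K - n)) (pow_ne_zero _ (Nat.cast_ne_zero.2 (F.P K).L_pos.ne')) (w := fun _ => (1 : ℝ))
        (fun _ => one_pos) (QE D (GE D (c := ((F.P K).L : ℝ) ^ (K - n)) (pow_ne_zero _ (Nat.cast_ne_zero.2 (F.P K).L_pos.ne')) (w := fun _ => (1 : ℝ))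
        (fun _ => one_pos) (WithLp.toLp 2 g)))) b :=
    ⟨(WithLp.linearEquiv 2 ℝ (PBond (F.P K) 0 → ℝ)).toLinearMap ∘ₗ
        (QsE D ∘ₗ EE D (c := ((F.P K).L : ℝ) ^ (K - n)) (pow_ne_zero _ (Nat.cast_ne_zero.2 (F.P K).L_pos.ne')) (w := fun _ => (1 : ℝ)) (fun _ => one_pos) ∘ₗ
          QE D ∘ₗ GE D (c := ((F.P K).L : ℝ) ^ (K - n)) (pow_ne_zero _ (Nat.cast_ne_zero.2 (F.P K).L_pos.ne')) (w := fun _ => (1 : ℝ)) (fun _ => one_pos)) ∘ₗ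
        (WithLp.linearEquiv 2 ℝ (PBond (F.P K) 0 → ℝ)).symm.toLinearMap,
      fun _ _ => rfl⟩
  -- k0-s1-w4's matrix letter read on the kernel extension `𝔐_V`
  have hMmat : ∀ (g : PBond (F.P K) 0 → Matrix (Fin N) (Fin N) ℂ) (β : ℝ), 0 ≤ β → (∀ b, w 3 b * ‖g b‖ ≤ β) →
      ∀ b ∈ {b : PBond (F.P K) 0 | b.src ∈ Y}, ‖MV g b‖ ≤ ((B₀ * B₃ + 1) * (F.L : ℝ) * CG) * β := by
    intro g β hβ hg b' hb'
    have hℳ : ∀ b, MV g b = ∑ b'', Mop (Pi.single b'' 1) b • g b'' := fun b => by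
      rw [hMV]
      refine Finset.sum_congr rfl fun j _ => ?_
      rw [Complex.coe_smul, hMop]
      rfl
    exact multiplierLetter_matrix_of_bodyAt_adm22 (P := F.P K) hDk hw hBody hδ₀.le hB₃.le hAdm hRM ha hGW hCG hGsup hband Mop hMop hY hβ hg hℳ b' hb'
  exact curlCurl_row_of_critical128_mat F K (K - n) w (fun m b => levWeight_nonneg hw m b) D hDV hGV hQV hHV hMV W hWq X hWA hWtr h128 hρ h1 h2 hslice
    (S := {b : PBond (F.P K) 0 | b.src ∈ Y}) (fun b hb => levWeight_eq_one_of_inOm_top hDk hw (hY _ hb) 3) hMmat f u r hf b hb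

end Record

/-! ## §4  The slice (153) at the head's datum tower `cubeDomains`, for every `H_V`-image of the gauge-fixed potential -/

section Slice

variable {P : Params}

/-- ★★ **(153) AT `cubeDomains` FOR THE CHART-SIDE FIELD `X = A + H_VB′`** ((157): `A′ = A + H𝔇(A′)`): n07-w3's `RE_dsE_re_eq_zero_of_cubeDomains` (the sixth conjunct
«`∃ A′`, `A = A′ ∘ cover` on `□₀` ∧ `IsLandau138 …`» for the gauge-fixed potential `A`, non-wrapping `□₀`) + p608822's `RE_dsE_re_reading_add_HV` (`R∂*H = 0`) ⇒ for every reading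
`Re φ`: `RE (cubeDomains …) c (dsE c (toLp (Re φ ∘ X))) = 0` at `c = η⁻¹` — LITERALLY the `hslice` binder of §2∕§3 and of p608822 §4 at `D := cubeDomains …`.
[cite: Balaban1985Variational, (153) p.301, (157) p.302, p.299; Balaban1984PropagatorsII, (2.12) p.225, (2.34)–(2.35) p.228] -/
theorem hslice_of_cubeDomains_add_HV {K' : ℕ} {Ω' : ℕ → Set (B7Prop1Explicit.Site P.d)} (cb : CubeB8 P.d P.L K' Ω')
    (hck : cb.k ≤ P.m + P.K) (hinj : Set.InjOn (cover P) (cb.sq 0)) {η c : ℝ} (hηc : η⁻¹ = c) (hc : c ≠ 0)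
    {w : BondIdx (cubeDomains P cb.a cb.M cb.ρ cb.k hck) → ℝ} (hw : ∀ i, 0 < w i) {A : PBond P 0 → MatA N}
    (h6 : ∃ A' : B7Prop1Explicit.Site P.d → Fin P.d → MatA N,
        (∀ x, x ∈ cb.sq 0 → ∀ μ, A ⟨cover P x, μ⟩ = A' x μ) ∧
        IsLandau138 P.L cb.k η (cb.sq 0) cb.lamS (1 : B7Prop1Explicit.Site P.d → Fin P.d → (MatA N)ˣ) A')
    [DecidableEq (BondIdx (cubeDomains P cb.a cb.M cb.ρ cb.k hck))]
    {HV : (BondIdx (cubeDomains P cb.a cb.M cb.ρ cb.k hck) → Matrix (Fin N) (Fin N) ℂ) →ₗ[ℂ] (PBond P 0 → Matrix (Fin N) (Fin N) ℂ)}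
    (hHV : ∀ (B : BondIdx (cubeDomains P cb.a cb.M cb.ρ cb.k hck) → Matrix (Fin N) (Fin N) ℂ) (b : PBond P 0),
      HV B b = ∑ t, ((WithLp.ofLp (hOp (GE (cubeDomains P cb.a cb.M cb.ρ cb.k hck) hc hw) (QsE (cubeDomains P cb.a cb.M cb.ρ cb.k hck))
        (EE (cubeDomains P cb.a cb.M cb.ρ cb.k hck) hc hw) (WithLp.toLp 2 (Pi.single t 1))) b : ℝ) : ℂ) • B t)
    (B' : BondIdx (cubeDomains P cb.a cb.M cb.ρ cb.k hck) → Matrix (Fin N) (Fin N) ℂ) {X : PBond P 0 → Matrix (Fin N) (Fin N) ℂ} (hX : X = A + HV B') :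
    ∀ φ : Matrix (Fin N) (Fin N) ℂ →L[ℂ] ℂ,
      RE (cubeDomains P cb.a cb.M cb.ρ cb.k hck) c (dsE c (WithLp.toLp 2 (fun b => (φ (X b)).re))) = 0 := by
  intro φ
  rw [hX, RE_dsE_re_reading_add_HV _ hc hw hHV φ A B']
  have h := RE_dsE_re_eq_zero_of_cubeDomains cb hck hinj h6 φ
  rwa [hηc] at h

end Slice

end Summit.QuantumFields.YangMills.Theorems.K0Stub1CurlCurlRowAtCubeDomains

end
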